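import Literature.NumberTheory.EllipticCurves.ZpExtensionEisensteinDVRSettingH4PerfectProofs
import Literature.NumberTheory.GaloisCohomology.Howard2004.DualityDatumLocalCupAnnihilatorLeftProofs
import HarnessLib

/-!
# H.4 at the places `v ∈ S` for the curve's Eisenstein setting, V: the `T`-side (left) duality inputs (Perf, left)
# and (Nondeg, right) of the FLIPPED descent at the induced local pairings of the levels

`Proofs` file (theorems only; no definition, no named fact, no instance, no `sorry`).  MIRROR of
`ZpExtensionEisensteinDVRSettingH4PerfectProofs` (x9-p1-w2 g7: the `Tw T`-side inputs `hPerf`/`hNondeg` of the descent for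
`hDualY`), for the flipped system `(Y, X, B.flip)` whose descent gives `hDualX`.

For the curve's tower `W.eisensteinTower κ hm` (`T^{(k)} = E_K[p^{k+1}] ⊗ A_{m,k+1}(ψ)`) and ANY H.4 data `D k` over `A_{m,k+1}`,
given only the Poitou–Tate named fact `poitouTate_selmerStructure_duality K` (a hypothesis):

* §0 (generic) `Tower.mem_levelCondition_top_of_forall_pairing_bot_eq_zero_of_range_left`: the descent lemma for the
  flipped system restated in the un-flipped pairing (the binder shapes below);
* §1 `eisensteinTower_scalarMapH1_mem_range_redIter`: `range H¹(K_v, red^{(d)}) ≤ H¹(K_v, T^{(k)})` is stable under the scalar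
  action of `A_{m,k+1}` (semilinearity of `red^{(d)}` over the SURJECTIVE `reduce`, x9-p1-w4's
  `scalarMapH1_mem_range_cohomologyMap_of_surjective`);
* §2 (Perf, left) `eisensteinTower_mem_range_of_forall_localCup_annihilator_left`: a class `x ∈ H¹(K_v, T^{(k)})` with
  «`∀ y, (∀ t ∈ range H¹(red^{(d)}), t ∪_k y = 0) → x ∪_k y = 0`» lies in `range H¹(red^{(d)})`
  (`DualityDatum.mem_of_forall_localCup_annihilator_eq_zero_left_of_isPerfect` through the bridge `λ_{k+1}`, `exp = log⁻¹`,
  `Θ` bijective, dual family — the pattern of the right-hand file);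
* §3 the package `eisensteinTower_localCup_towerDuality_left`: (Perf, left) at the images `range (red^{(d)})` of the
  `T`-side tower and (Nondeg, right) at every level `k + d`, in the binder shapes `hPerf`, `hNondeg` of
  `Tower.mem_levelCondition_top_of_forall_pairing_bot_eq_zero_of_range` for `(Y, X, fun j ↦ (B j).flip)`
  (`AddMonoidHom.flip_apply` is `rfl`), `X_j = H¹(K_v, T^{(j)})`, `Y_j = H¹(K_v, Tw T^{(j)})`, `B_j = (D j).localCup (inr v)`.

Cell `pub/bsd-print-x9` (STUB A `hfin4`, brick (M1) of the custodian's assembly split).  No summit statement is proved here;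
BSD is not proved by any of this.  References: [Howard2004HeegnerKolyvagin] §1.3 H.4 (arXiv:1202.6340 p. 7 L78–82), Def. 1.1.1,
§1.6 (p. 12), Def. 3.1.2; [MilneADT2006] I §0 Prop. 0.19, Cor. 2.3; [SerreGaloisCohomology1997] I §2.2, §5.1.
-/

set_option autoImplicit false

noncomputable section

open Function NumberField IsDedekindDomain Field
open scoped NumberField ContRepresentation

/-! ## §0 (generic) The flipped descent, restated in the un-flipped pairing -/

namespace Literature.NumberTheory.EllipticCurves.Tower

universe u v w

variable {X : ℕ → Type u} [∀ j, AddCommGroup (X j)] (red : ∀ j, X (j + 1) →+ X j)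
variable {Y : ℕ → Type v} [∀ j, AddCommGroup (Y j)] (red' : ∀ j, Y (j + 1) →+ Y j)
variable {Q : ℕ → Type w} [∀ j, AddCommGroup (Q j)] (B : ∀ j, X j →+ Y j →+ Q j)

/-- **(Dual) on the `X`-side from four level inputs** — x9-p1-w4's
`mem_levelCondition_top_of_forall_pairing_bot_eq_zero_of_range` applied to the FLIPPED system `(Y, X, fun j ↦ (B j).flip)` and
restated in the un-flipped pairing (`AddMonoidHom.flip_apply` is `rfl`): (Perf, left) at the images `red^{(d)}(X_{k+d})`,
(Adj-mirror) `incQ d (B k (red^{(d)} w) y) = B (k + d) w (up′ d y)`, (Nondeg, right) at every level `k + d`, and (Ker-Y)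
`ker up′_d ⊆ levelCondition red′ p ⊥ k` give: a class `x ∈ X_k` orthogonal to the bottom condition of `Y` lifts to the limit
(`x ∈ levelCondition red p ⊤ k`) — the input `hDualX` of the exact-annihilator descent.
[cite: MilneADT2006, Ch. I §0 Prop. 0.19 and Cor. 2.3] [cite: Howard2004HeegnerKolyvagin, H.4 (arXiv p. 7, L78–82)] -/
theorem mem_levelCondition_top_of_forall_pairing_bot_eq_zero_of_range_left [∀ j, Finite (X j)] (p : ℕ) (k : ℕ)
    (up' : ∀ d : ℕ, Y k →+ Y (k + d)) (incQ : ∀ d : ℕ, Q k →+ Q (k + d))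
    (hPerf : ∀ (d : ℕ) (x : X k),
      (∀ y : Y k, (∀ t ∈ (redIter red k d).range, B k t y = 0) → B k x y = 0) → x ∈ (redIter red k d).range)
    (hAdj : ∀ (d : ℕ) (y : Y k) (w : X (k + d)),
      incQ d (B k (redIter red k d w) y) = B (k + d) w (up' d y))
    (hNondeg : ∀ (d : ℕ) (y : Y (k + d)), (∀ w : X (k + d), B (k + d) w y = 0) → y = 0)
    (hKer : ∀ (d : ℕ) (y : Y k), up' d y = 0 →
      y ∈ levelCondition red' p (fun _ ↦ (⊥ : AddSubgroup (Y _))) k)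
    (x : X k) (hx : ∀ y ∈ levelCondition red' p (fun _ ↦ (⊥ : AddSubgroup (Y _))) k, B k x y = 0) :
    x ∈ levelCondition red p (fun _ ↦ (⊤ : AddSubgroup (X _))) k :=
  mem_levelCondition_top_of_forall_pairing_bot_eq_zero_of_range red' red (fun j ↦ (B j).flip) p k up' incQ
    hPerf hAdj hNondeg hKer x hx

end Literature.NumberTheory.EllipticCurves.Tower

namespace WeierstrassCurve

open Literature.NumberTheory.EllipticCurves Literature.NumberTheory.GaloisRepresentations
open Literature.NumberTheory.GaloisRepresentations.DiscreteGaloisModule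
open Literature.NumberTheory.GaloisCohomology Literature.NumberTheory.GaloisCohomology.Howard2004
open Literature.NumberTheory.EllipticCurves.ZpExtension (EisensteinLevel)

variable {K : Type} [Field K] [NumberField K] (W : WeierstrassCurve ℚ) [W.IsElliptic] {p : ℕ} [hp : Fact p.Prime]
  (κ : ZpExtension K p) {m : ℕ} (hm : 1 ≤ m)

/-! ## §1 `range H¹(K_v, red^{(d)})` on the `T`-side is stable under the scalar action of `A_{m,k+1}` -/

/-- **`range H¹(K_v, red^{(d)}) ≤ H¹(K_v, T^{(k)})` is stable under the scalar action of `A_{m,k+1}`** — the hypothesis `hT` of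
`DualityDatum.mem_of_forall_localCup_annihilator_eq_zero_left_of_isPerfect` at Howard's images (local conditions are
`R`-submodules): `red^{(d)}` is semilinear over the SURJECTIVE ring reduction `A_{m,k+d+1} → A_{m,k+1}`.
[cite: Howard2004HeegnerKolyvagin, §1.3 H.4 and Def. 1.1.1] [cite: SerreGaloisCohomology1997, I §2.2 and §5.1] -/
theorem eisensteinTower_scalarMapH1_mem_range_redIter (k d : ℕ) (v : Place K)
    {ι : Type} (rfam : ι → IwasawaAlgebra.EisensteinCoeff p m (k + 1)) (i : ι)
    (t : letI := IwasawaAlgebra.isLocalRing_quotient_X_pow_add_C p hm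
      galoisCohomology (((W.eisensteinTower κ hm).ρ k).toLocal v) 1)
    (ht : letI := IwasawaAlgebra.isLocalRing_quotient_X_pow_add_C p hm
      t ∈ (ContinuousRep.cohomologyMap (((W.eisensteinTower κ hm).ρ (k + d)).toLocal v)
        (((W.eisensteinTower κ hm).ρ k).toLocal v) ((W.eisensteinTower κ hm).redIter k d).toAddMonoidHom
        continuous_of_discreteTopology (fun _ z => (W.eisensteinTower κ hm).redIter_equivariant k d _ z) 1).range) :
    letI := IwasawaAlgebra.isLocalRing_quotient_X_pow_add_C p hm
    galoisCohomology.scalarMapH1 (((W.eisensteinTower κ hm).ρ k).toLocal v)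
        (DualityDatum.isScalarLinear_toLocal
          (κ.isScalarLinear_eisensteinAdicTowerSucc_coeff (fun j ↦ (W.baseChange K).torsionGaloisModule ((p : ℤ) ^ j))
            (fun j ↦ (W.baseChange K).torsionGaloisModuleReduce p j) hm
            (fun j ↦ (W.baseChange K).torsionGaloisModuleReduce_surjective p j) k) v) (rfam i) t ∈
      (ContinuousRep.cohomologyMap (((W.eisensteinTower κ hm).ρ (k + d)).toLocal v)
        (((W.eisensteinTower κ hm).ρ k).toLocal v) ((W.eisensteinTower κ hm).redIter k d).toAddMonoidHom
        continuous_of_discreteTopology (fun _ z => (W.eisensteinTower κ hm).redIter_equivariant k d _ z) 1).range := by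
  letI := IwasawaAlgebra.isLocalRing_quotient_X_pow_add_C p hm
  exact DualityDatum.scalarMapH1_toLocal_mem_range
    (κ.isScalarLinear_eisensteinAdicTowerSucc_coeff _ _ hm _ k)
    (κ.isScalarLinear_eisensteinAdicTowerSucc_coeff _ _ hm _ (k + d))
    ((W.eisensteinTower κ hm).redIter k d).toAddMonoidHom
    (fun g z => (W.eisensteinTower κ hm).redIter_equivariant k d g z) _
    (IwasawaAlgebra.EisensteinCoeff.reduce_surjective m _)
    (fun a z => W.eisensteinTower_redIter_smul κ hm k d a z) v rfam i t ht

/-! ## §2 (Perf, left) for the induced local pairing of level `k` -/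

variable (cd : ConjugationDatum K)
  (D : letI := IwasawaAlgebra.isLocalRing_quotient_X_pow_add_C p hm
    ∀ k, DualityDatum p cd ((W.eisensteinTower κ hm).ρ k) (IwasawaAlgebra.EisensteinCoeff p m (k + 1)))

/-- **(Perf, left) at the images of the iterated reductions.**  At a finite place `v`, for ANY H.4 data `D k` of the curve's
tower: a class `x ∈ H¹(K_v, T^{(k)})` which pairs to zero (under `∪_k`) with every class annihilating `range H¹(K_v, red^{(d)})`
lies in that range — finite-level Tate duality (`poitouTate_selmerStructure_duality K`, hypothesis) read through the dualizing
family of `A_{m,k+1}`, the range being `A_{m,k+1}`-stable (§1).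
[cite: Howard2004HeegnerKolyvagin, §1.3 H.4 (arXiv p. 7, L78–82) and Def. 1.1.1] [cite: MilneADT2006, Ch. I §0 Prop. 0.19 and Cor. 2.3] -/
theorem eisensteinTower_mem_range_of_forall_localCup_annihilator_left (hPT : poitouTate_selmerStructure_duality K)
    (k d : ℕ) (v : HeightOneSpectrum (𝓞 K))
    (x : letI := IwasawaAlgebra.isLocalRing_quotient_X_pow_add_C p hm
      galoisCohomology (((W.eisensteinTower κ hm).ρ k).toLocal (Sum.inr v)) 1)
    (hx : letI := IwasawaAlgebra.isLocalRing_quotient_X_pow_add_C p hm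
      ∀ y : galoisCohomology ((cd.twist ((W.eisensteinTower κ hm).ρ k)).toLocal (Sum.inr v)) 1,
        (∀ t ∈ (ContinuousRep.cohomologyMap (((W.eisensteinTower κ hm).ρ (k + d)).toLocal (Sum.inr v))
            (((W.eisensteinTower κ hm).ρ k).toLocal (Sum.inr v))
            ((W.eisensteinTower κ hm).redIter k d).toAddMonoidHom continuous_of_discreteTopology
            (fun _ z => (W.eisensteinTower κ hm).redIter_equivariant k d _ z) 1).range,
          (D k).localCup (Sum.inr v) t y = 0) →
        (D k).localCup (Sum.inr v) x y = 0) :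
    letI := IwasawaAlgebra.isLocalRing_quotient_X_pow_add_C p hm
    x ∈ (ContinuousRep.cohomologyMap (((W.eisensteinTower κ hm).ρ (k + d)).toLocal (Sum.inr v))
      (((W.eisensteinTower κ hm).ρ k).toLocal (Sum.inr v))
      ((W.eisensteinTower κ hm).redIter k d).toAddMonoidHom continuous_of_discreteTopology
      (fun _ z => (W.eisensteinTower κ hm).redIter_equivariant k d _ z) 1).range := by
  letI := IwasawaAlgebra.isLocalRing_quotient_X_pow_add_C p hm
  have hpp := hp.out
  haveI : NeZero (p ^ (k + 1)) := ⟨pow_ne_zero _ hpp.ne_zero⟩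
  have hpK : (p : K) ≠ 0 := by exact_mod_cast hpp.ne_zero
  haveI : Finite (geomTorsion (W.baseChange K) ((p : ℤ) ^ (k + 1))) :=
    finite_torsionPoints_holds (W.baseChange K) (AlgebraicClosure K) (n := (p : ℤ) ^ (k + 1))
      (pow_ne_zero _ (by exact_mod_cast hpp.ne_zero))
  haveI : Finite (EisensteinLevel p m (fun j ↦ geomTorsion (W.baseChange K) ((p : ℤ) ^ j)) (k + 1)) :=
    IwasawaAlgebra.EisensteinCoeff.finite_twisted (p := p) (k := k + 1)
      (M := geomTorsion (W.baseChange K) ((p : ℤ) ^ (k + 1))) hm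
  have hM := W.eisensteinLevel_succ_pow_nsmul_eq_zero (K := K) (p := p) hm k
  -- the bridge data `λ = λ_{k+1}` (tail form) and `exp = log⁻¹`
  have hlam : ∀ (z : ℤ_[p]) (r : IwasawaAlgebra.EisensteinCoeff p m (k + 1)),
      (IwasawaAlgebra.EisensteinCoeff.tailFormZMod p hm (k + 1)).toAddMonoidHom
          (algebraMap ℤ_[p] (IwasawaAlgebra.EisensteinCoeff p m (k + 1)) z * r) =
        PadicInt.toZModPow (k + 1) z *
          (IwasawaAlgebra.EisensteinCoeff.tailFormZMod p hm (k + 1)).toAddMonoidHom r := fun z r ↦ by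
    rw [LinearMap.toAddMonoidHom_coe, IwasawaAlgebra.EisensteinCoeff.algebraMap_padicInt_eq_ofZMod_toZModPow p hm (k + 1),
      IwasawaAlgebra.EisensteinCoeff.tailFormZMod_ofZMod_mul]
  obtain ⟨log, hlogbij, hlogχ, -⟩ := exists_compatible_muLog K p hpK
  let Lg : MuCarrier K (p ^ (k + 1)) ≃+ ZMod (p ^ (k + 1)) := AddEquiv.ofBijective (log (k + 1)) (hlogbij (k + 1))
  have hexpb : Function.Bijective (Lg.symm : ZMod (p ^ (k + 1)) →+ MuCarrier K (p ^ (k + 1))) := Lg.symm.bijective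
  have hexp : ∀ (g : absoluteGaloisGroup K) (x : ZMod (p ^ (k + 1))),
      (Lg.symm : ZMod (p ^ (k + 1)) →+ MuCarrier K (p ^ (k + 1))) (cyclotomicCharacterModPow K p (k + 1) g * x) =
        mu K (p ^ (k + 1)) g ((Lg.symm : ZMod (p ^ (k + 1)) →+ MuCarrier K (p ^ (k + 1))) x) := fun g x ↦ by
    apply Lg.injective
    change Lg (Lg.symm _) = log (k + 1) (mu K _ g (Lg.symm x))
    rw [AddEquiv.apply_symm_apply, hlogχ, show log (k + 1) (Lg.symm x) = Lg (Lg.symm x) from rfl,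
      AddEquiv.apply_symm_apply]
  -- `Θ : Tw(T^{(k)}) → Hom(T^{(k)}, μ)` is bijective, and the dual family dualizes `A_{m,k+1}(1)`
  have hΘ := (D k).toTateDual_bijective _ hlam _ hexp hexpb
    (IwasawaAlgebra.EisensteinCoeff.tailFormZModComp_bijective p hm (k + 1))
  have hbij := IwasawaAlgebra.EisensteinCoeff.bijective_comp_tailFormZMod_dualFamily_mul p hm (k + 1) _ hexpb
  -- the Poitou–Tate family of local invariants at `n = p^{k+1}`
  obtain ⟨inv, hperf, -, -, -⟩ := hPT (p ^ (k + 1))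
  exact (D k).mem_of_forall_localCup_annihilator_eq_zero_left_of_isPerfect _ hlam _ hexp
    (κ.isScalarLinear_eisensteinAdicTowerSucc_coeff _ _ hm _ k) v hM hΘ inv hperf
    (IwasawaAlgebra.EisensteinCoeff.dualFamily p hm (k + 1)) hbij _
    (fun i t ht ↦ W.eisensteinTower_scalarMapH1_mem_range_redIter κ hm k d (Sum.inr v)
      (IwasawaAlgebra.EisensteinCoeff.dualFamily p hm (k + 1)) i t ht) x hx

/-! ## §3 (Perf, left) and (Nondeg, right) in the binder shapes of the flipped descent -/

/-- **The `T`-side duality level inputs of the flipped H.4 descent for the curve's Eisenstein setting at a finite place `v`**: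
for the `D`-indexed towers `X_j = H¹(K_v, T^{(j)})` (one-step maps `H¹(red_j)`), `Y_j = H¹(K_v, Tw T^{(j)})`, pairings
`B_j = (D j).localCup (Sum.inr v)` and every base level `k`: (Perf, left) at the images `range (red^{(d)})` of the `T`-side tower
and (Nondeg, right) at every level `k + d` — the hypotheses `hPerf`, `hNondeg` of
`Tower.mem_levelCondition_top_of_forall_pairing_bot_eq_zero_of_range` for `(Y, X, fun j ↦ (B j).flip)`, given the Poitou–Tate
named fact. [cite: Howard2004HeegnerKolyvagin, §1.3 H.4 (arXiv p. 7, L78–82), Def. 1.1.1 and Def. 3.1.2]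
[cite: MilneADT2006, Ch. I §0 Prop. 0.19 and Cor. 2.3] -/
theorem eisensteinTower_localCup_towerDuality_left (hPT : poitouTate_selmerStructure_duality K)
    (v : HeightOneSpectrum (𝓞 K)) (k : ℕ) :
    letI := IwasawaAlgebra.isLocalRing_quotient_X_pow_add_C p hm
    (∀ (d : ℕ) (x : galoisCohomology (((W.eisensteinTower κ hm).ρ k).toLocal (Sum.inr v)) 1),
        (∀ y : galoisCohomology ((cd.twist ((W.eisensteinTower κ hm).ρ k)).toLocal (Sum.inr v)) 1,
          (∀ t ∈ (Tower.redIter (H := fun j ↦ galoisCohomology (((W.eisensteinTower κ hm).ρ j).toLocal (Sum.inr v)) 1)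
              (fun j ↦ ContinuousRep.cohomologyMap (((W.eisensteinTower κ hm).ρ (j + 1)).toLocal (Sum.inr v))
                (((W.eisensteinTower κ hm).ρ j).toLocal (Sum.inr v)) ((W.eisensteinTower κ hm).red j).toAddMonoidHom
                continuous_of_discreteTopology (fun _ z => (W.eisensteinTower κ hm).red_equivariant j _ z) 1) k d).range,
            (D k).localCup (Sum.inr v) t y = 0) → (D k).localCup (Sum.inr v) x y = 0) →
        x ∈ (Tower.redIter (H := fun j ↦ galoisCohomology (((W.eisensteinTower κ hm).ρ j).toLocal (Sum.inr v)) 1)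
          (fun j ↦ ContinuousRep.cohomologyMap (((W.eisensteinTower κ hm).ρ (j + 1)).toLocal (Sum.inr v))
            (((W.eisensteinTower κ hm).ρ j).toLocal (Sum.inr v)) ((W.eisensteinTower κ hm).red j).toAddMonoidHom
            continuous_of_discreteTopology (fun _ z => (W.eisensteinTower κ hm).red_equivariant j _ z) 1) k d).range) ∧
      ∀ (d : ℕ) (y : galoisCohomology ((cd.twist ((W.eisensteinTower κ hm).ρ (k + d))).toLocal (Sum.inr v)) 1),
        (∀ w : galoisCohomology (((W.eisensteinTower κ hm).ρ (k + d)).toLocal (Sum.inr v)) 1,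
          (D (k + d)).localCup (Sum.inr v) w y = 0) → y = 0 := by
  letI := IwasawaAlgebra.isLocalRing_quotient_X_pow_add_C p hm
  refine ⟨fun d x hx ↦ ?_, fun d y hy ↦ (W.eisensteinTower_localCup_nondegenerate κ hm cd D hPT (k + d) v).2 y hy⟩
  rw [(W.eisensteinTower κ hm).redIter_cohomologyMap_toLocal_eq' (Sum.inr v) k d] at hx ⊢
  exact W.eisensteinTower_mem_range_of_forall_localCup_annihilator_left κ hm cd D hPT k d v x hx

end WeierstrassCurve

end
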